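import Summits.Ventures.CertifiedManyBodySolver.Downfold.BoxesHg1201TpLadderSigmaFS
import Summits.Ventures.CertifiedManyBodySolver.Downfold.EmeryFermiFillingHg1201
import HarnessLib

/-!
# `t'` ladder of HgBa₂CuO₄₊δ, part 10b: the BY-NAME ties of part 10's typed windows W0 / W10 to mod-4's kernel words
# (`EmeryFermiFillingHg1201`: `Emery.emeryBoxHg1201v114_fsRatio_window`, `Emery.emeryBoxHg1201P10_fsRatio_window`)

Venture CertifiedManyBodySolver, cell `pub/hubbard-downfold` (D-0154 (1)(C) COVERAGE (ii) «Hg-1201»; seat `hubbard-cov-hg1201-unc-3` g10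
(`prover-hubbard-cov-hg1201-unc-3-g9-0`)); namespace `Summit.Ventures.CertifiedManyBodySolver.Downfold`. Split off part 10 (`BoxesHg1201TpLadderSigmaFS`)
only because it must import the device's box-level file; everything here is PROVED and is ONE application of mod-4's word per pressure: at every parameter
vector of the typed three-band box of record and every Fermi energy carrying the box's own electron count, the σ-model Fermi-surface ratio `Emery.fsRatio` is a
member of part 10's typed entry — `hg1201_P0_tp_sigmaFS = [−3717/10000, −1243/5000]` on `emeryBoxHg1201v114` (P = 0, §OF-RECORD v1.14) and
`hg1201_P10_tp_sigmaFS = [−1611/5000, −97/400]` on `emeryBoxHg1201P10` (P = 10 GPa) — so the literals of part 10 are the kernel's, not a transcription.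
HONEST FRAMING: SCREENING-GRADE boxes; the device certifies the reduction step of the σ model only (mod-4's words); no box row, word, bar, leaf or coverage
statement moves; no phase sentence; no summit statement is proved by this seat.
References: three-band model [HybertsenSchluterChristensen1989, Eq. (1)].
-/

noncomputable section

namespace Summit.Ventures.CertifiedManyBodySolver.Downfold

open Set NonemptyInterval

/-- **BY-NAME TIE @0**: mod-4's kernel word `Emery.emeryBoxHg1201v114_fsRatio_window` says exactly that the σ-model Fermi-surface ratio lies in the
typed entry `hg1201_P0_tp_sigmaFS` at every parameter vector of `emeryBoxHg1201v114` and every Fermi energy carrying the box's electron count.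
[cite: HybertsenSchluterChristensen1989, Eq. (1) (three-band d–p model)] -/
theorem hg1201_P0_tp_sigmaFS_of_certificate :
    HoldsOn (fun p : EmeryCoord → ℝ => ∀ ε : ℝ,
      Emery.abFilling (p .DeltaPd) (p .tpd) (p .tpp) (p .tppP) ε = (2 - p .nHoles) / 2 →
      hg1201_P0_tp_sigmaFS.Mem (Emery.fsRatio (p .DeltaPd) (p .tpd) (p .tpp) (p .tppP) ε)) emeryBoxHg1201v114 := by
  intro p hp ε hf
  have h := (Emery.emeryBoxHg1201v114_fsRatio_window p hp ε hf).2
  refine (Entry.mem_ofEnds_iff _ _ _ _ _).2 ⟨?_, ?_⟩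
  · have h1 := h.1
    push_cast
    linarith
  · have h2 := h.2
    push_cast
    linarith

/-- **BY-NAME TIE @10**: the same for `Emery.emeryBoxHg1201P10_fsRatio_window` and `hg1201_P10_tp_sigmaFS` on `emeryBoxHg1201P10`.
[cite: HybertsenSchluterChristensen1989, Eq. (1) (three-band d–p model)] -/
theorem hg1201_P10_tp_sigmaFS_of_certificate :
    HoldsOn (fun p : EmeryCoord → ℝ => ∀ ε : ℝ,
      Emery.abFilling (p .DeltaPd) (p .tpd) (p .tpp) (p .tppP) ε = (2 - p .nHoles) / 2 →
      hg1201_P10_tp_sigmaFS.Mem (Emery.fsRatio (p .DeltaPd) (p .tpd) (p .tpp) (p .tppP) ε)) emeryBoxHg1201P10 := by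
  intro p hp ε hf
  have h := (Emery.emeryBoxHg1201P10_fsRatio_window p hp ε hf).2
  refine (Entry.mem_ofEnds_iff _ _ _ _ _).2 ⟨?_, ?_⟩
  · have h1 := h.1
    push_cast
    linarith
  · have h2 := h.2
    push_cast
    linarith

/-- **Both ties in one line** (citable): the kernel windows of `EmeryFermiFillingHg1201` ARE part 10's entries W0 / W10. [folklore] -/
theorem hg1201_tp_sigmaFS_of_certificates :
    HoldsOn (fun p : EmeryCoord → ℝ => ∀ ε : ℝ,
        Emery.abFilling (p .DeltaPd) (p .tpd) (p .tpp) (p .tppP) ε = (2 - p .nHoles) / 2 →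
        hg1201_P0_tp_sigmaFS.Mem (Emery.fsRatio (p .DeltaPd) (p .tpd) (p .tpp) (p .tppP) ε)) emeryBoxHg1201v114 ∧
      HoldsOn (fun p : EmeryCoord → ℝ => ∀ ε : ℝ,
        Emery.abFilling (p .DeltaPd) (p .tpd) (p .tpp) (p .tppP) ε = (2 - p .nHoles) / 2 →
        hg1201_P10_tp_sigmaFS.Mem (Emery.fsRatio (p .DeltaPd) (p .tpd) (p .tpp) (p .tppP) ε)) emeryBoxHg1201P10 :=
  ⟨hg1201_P0_tp_sigmaFS_of_certificate, hg1201_P10_tp_sigmaFS_of_certificate⟩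

end Summit.Ventures.CertifiedManyBodySolver.Downfold

end
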